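import Literature.Combinatorics.Designs.LegendrePairs

/-!
# The two-circulant-core plug-in: a Legendre pair of length `ℓ` gives a Hadamard matrix of order `2ℓ + 2`

[Fletcher–Gysin–Seberry, Australas. J. Combin. 23 (2001) 75–86] (`FletcherGysinSeberry2001`, §1): if `(a, b)` is a
Legendre pair of length `ℓ` (two `±1` sequences with `PAF_a(s) + PAF_b(s) = -2` for `s ≠ 0`), normalised to row sums
`+1`, and `A, B` are the circulants with first rows `a, b`, then

  `H = [[-1, -1,  e,   e ],
        [-1,  1,  e,  -e ],
        [ eᵀ, eᵀ, A,   B ],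
        [ eᵀ,-eᵀ, Bᵀ, -Aᵀ]]`      (`e` the all-ones row of length `ℓ`)

is a Hadamard matrix of order `2ℓ + 2` ("Hadamard matrix with two circulant cores").  This is the plug-in by which a
Legendre pair of length `333` would give a Hadamard matrix of order `668`; `LegendrePairs.lean` deliberately left it
out, this file supplies it: `twoCircCore_mul_transpose` (`H Hᵀ = (2ℓ+2) I`), `twoCircCore_pm` (entries `±1`), and the
normalisation-free existence statement `exists_hadamard_of_legendrePair` (one of `a, -a` has row sum `+1`, by
`rowsum_sq`).  The matrix is indexed by `(Unit ⊕ Unit) ⊕ (ZMod ℓ ⊕ ZMod ℓ)` and written entrywise; the verification is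
sixteen block cases, each a row-sum, a periodic-autocorrelation or a convolution-symmetry identity.
Our formalisation of the published construction (cell pub-namedobj, target H).  No `sorry`, no new axioms.
-/

open Matrix BigOperators Finset

namespace Literature.Combinatorics.Designs.LegendrePairs

variable {n : ℕ} [NeZero n]

/-- index type of the bordered two-circulant matrix of order `2n + 2`: two border rows/columns, then the two cores.
[cite: FletcherGysinSeberry2001, §1 (the 2×(ℓ+1) plug-in)] -/
abbrev CoreIdx (n : ℕ) : Type := (Unit ⊕ Unit) ⊕ (ZMod n ⊕ ZMod n)

/-- the two-circulant-core matrix `[[-1,-1,e,e],[-1,1,e,-e],[eᵀ,eᵀ,A,B],[eᵀ,-eᵀ,Bᵀ,-Aᵀ]]` on first rows `a, b`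
(`A i j = a (i - j)`, `B i j = b (i - j)`). [cite: FletcherGysinSeberry2001, §1 (the 2×(ℓ+1) plug-in)] -/
def twoCircCore (a b : ZMod n → ℤ) : Matrix (CoreIdx n) (CoreIdx n) ℤ := Matrix.of fun x y =>
  match x, y with
  | Sum.inl (Sum.inl _), Sum.inl (Sum.inl _) => -1
  | Sum.inl (Sum.inl _), Sum.inl (Sum.inr _) => -1
  | Sum.inl (Sum.inl _), Sum.inr (Sum.inl _) => 1
  | Sum.inl (Sum.inl _), Sum.inr (Sum.inr _) => 1
  | Sum.inl (Sum.inr _), Sum.inl (Sum.inl _) => -1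
  | Sum.inl (Sum.inr _), Sum.inl (Sum.inr _) => 1
  | Sum.inl (Sum.inr _), Sum.inr (Sum.inl _) => 1
  | Sum.inl (Sum.inr _), Sum.inr (Sum.inr _) => -1
  | Sum.inr (Sum.inl _), Sum.inl (Sum.inl _) => 1
  | Sum.inr (Sum.inl _), Sum.inl (Sum.inr _) => 1
  | Sum.inr (Sum.inl i), Sum.inr (Sum.inl j) => a (i - j)
  | Sum.inr (Sum.inl i), Sum.inr (Sum.inr j) => b (i - j)
  | Sum.inr (Sum.inr _), Sum.inl (Sum.inl _) => 1
  | Sum.inr (Sum.inr _), Sum.inl (Sum.inr _) => -1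
  | Sum.inr (Sum.inr i), Sum.inr (Sum.inl j) => b (j - i)
  | Sum.inr (Sum.inr i), Sum.inr (Sum.inr j) => -a (j - i)

/-! ### reindexing identities over `ZMod n` -/

/-- row sums of a circulant are the sequence sum. [folklore] -/
private lemma sum_sub_left (x : ZMod n → ℤ) (k : ZMod n) : ∑ c, x (k - c) = ∑ c, x c :=
  Fintype.sum_equiv (Equiv.subLeft k) _ _ (fun _ => rfl)

/-- column sums of a circulant are the sequence sum. [folklore] -/
private lemma sum_sub_right (x : ZMod n → ℤ) (k : ZMod n) : ∑ c, x (c - k) = ∑ c, x c :=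
  Fintype.sum_equiv (Equiv.subRight k) _ _ (fun _ => rfl)

/-- `(A Aᵀ) i k = PAF_a (k - i)`. [folklore] -/
private lemma sum_mul_sub_left (x : ZMod n → ℤ) (i k : ZMod n) :
    ∑ c, x (i - c) * x (k - c) = PAF x (k - i) := by
  unfold PAF
  refine Fintype.sum_equiv (Equiv.subLeft i) _ _ (fun c => ?_)
  simp only [Equiv.subLeft_apply]
  congr 1; congr 1; abel

/-- `(Aᵀ A) i k = PAF_a (k - i)`. [folklore] -/
private lemma sum_mul_sub_right (x : ZMod n → ℤ) (i k : ZMod n) :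
    ∑ c, x (c - i) * x (c - k) = PAF x (k - i) := by
  unfold PAF
  rw [show (∑ c, x (c - i) * x (c - k)) = ∑ c, x (c - k) * x (c - i) from
    Finset.sum_congr rfl (fun c _ => mul_comm _ _)]
  refine Fintype.sum_equiv (Equiv.subRight k) _ _ (fun c => ?_)
  simp only [Equiv.subRight_apply]
  congr 1; congr 1; abel

/-- `A B = B A` entrywise in convolution form: `Σ_c x (i - c) y (c - k) = Σ_c y (i - c) x (c - k)`. [folklore] -/
private lemma conv_comm (x y : ZMod n → ℤ) (i k : ZMod n) :
    ∑ c, x (i - c) * y (c - k) = ∑ c, y (i - c) * x (c - k) := by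
  refine Fintype.sum_equiv (Equiv.subLeft (i + k)) _ _ (fun c => ?_)
  simp only [Equiv.subLeft_apply]
  rw [mul_comm]
  congr 1 <;> (congr 1; abel)

/-- `Bᵀ A = Aᵀ B`-type symmetry: `Σ_c x (c - i) y (k - c) = Σ_c y (c - i) x (k - c)`. [folklore] -/
private lemma conv_comm' (x y : ZMod n → ℤ) (i k : ZMod n) :
    ∑ c, x (c - i) * y (k - c) = ∑ c, y (c - i) * x (k - c) := by
  refine Fintype.sum_equiv (Equiv.subLeft (i + k)) _ _ (fun c => ?_)
  simp only [Equiv.subLeft_apply]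
  rw [mul_comm]
  congr 1 <;> (congr 1; abel)

/-! ### the Gram identity -/

/-- the Legendre condition in the form used below: `PAF_a(k-i) + PAF_b(k-i)` is `2n` on the diagonal and `-2` off it.
[cite: FletcherGysinSeberry2001, §1 (definition of a Legendre pair)] -/
lemma paf_add_paf (a b : ZMod n → ℤ) (h : LegendrePair a b) (i k : ZMod n) :
    PAF a (k - i) + PAF b (k - i) = if i = k then 2 * (n : ℤ) else -2 := by
  obtain ⟨ha, hb, hL⟩ := h
  split_ifs with hik
  · subst hik; rw [sub_self, paf_zero a ha, paf_zero b hb]; ring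
  · exact hL _ (sub_ne_zero.mpr (Ne.symm hik))

/-- **Two circulant cores: `H Hᵀ = (2ℓ + 2) I`.**  For a Legendre pair `(a, b)` of length `n` with row sums `+1`,
the bordered two-circulant matrix is orthogonal with Gram constant `2n + 2`.
[cite: FletcherGysinSeberry2001, §1 (the 2×(ℓ+1) plug-in)] -/
theorem twoCircCore_gram (a b : ZMod n → ℤ) (h : LegendrePair a b) (ha1 : ∑ i, a i = 1) (hb1 : ∑ i, b i = 1)
    (x y : CoreIdx n) :
    ∑ z, twoCircCore a b x z * twoCircCore a b y z = if x = y then 2 * (n : ℤ) + 2 else 0 := by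
  have hP := paf_add_paf a b h
  have hn : (Fintype.card (ZMod n) : ℤ) = n := by simp [ZMod.card]
  rcases x with ⟨⟨⟩ | ⟨⟩⟩ | ⟨i | i⟩ <;> rcases y with ⟨⟨⟩ | ⟨⟩⟩ | ⟨k | k⟩ <;>
    simp only [twoCircCore, Matrix.of_apply, Fintype.sum_sum_type, Finset.sum_const, Finset.card_univ,
      Fintype.card_unique, one_smul, mul_one, mul_neg, neg_mul, neg_neg, one_mul,
      Finset.sum_neg_distrib, sum_sub_left, sum_sub_right, sum_mul_sub_left, sum_mul_sub_right, ha1, hb1,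
      Sum.inl.injEq, Sum.inr.injEq, reduceCtorEq, if_true, if_false, hn, nsmul_eq_mul] <;>
    first
      | (rw [add_assoc, hP i k]; split_ifs <;> ring)
      | (rw [add_assoc, add_comm (PAF b _) (PAF a _), hP i k]; split_ifs <;> ring)
      | (rw [conv_comm a b i k]; ring)
      | (rw [conv_comm' b a i k]; ring)
      | ring

/-- **Two circulant cores, matrix form**: `H Hᵀ = (2n + 2)·I` for the bordered two-circulant matrix of a Legendre
pair with row sums `+1`. [cite: FletcherGysinSeberry2001, §1 (the 2×(ℓ+1) plug-in)] -/
theorem twoCircCore_mul_transpose (a b : ZMod n → ℤ) (h : LegendrePair a b) (ha1 : ∑ i, a i = 1)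
    (hb1 : ∑ i, b i = 1) :
    twoCircCore a b * (twoCircCore a b)ᵀ = (2 * (n : ℤ) + 2) • (1 : Matrix (CoreIdx n) (CoreIdx n) ℤ) := by
  ext x y
  rw [Matrix.mul_apply]
  simp only [Matrix.transpose_apply, Matrix.smul_apply, Matrix.one_apply, smul_eq_mul, mul_ite, mul_one, mul_zero]
  exact twoCircCore_gram a b h ha1 hb1 x y

omit [NeZero n] in
/-- the entries of the bordered two-circulant matrix are `±1` when `a, b` are. [cite: FletcherGysinSeberry2001, §1 (the 2×(ℓ+1) plug-in)] -/
theorem twoCircCore_pm (a b : ZMod n → ℤ) (ha : IsPM a) (hb : IsPM b) (x y : CoreIdx n) :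
    twoCircCore a b x y = 1 ∨ twoCircCore a b x y = -1 := by
  have hneg : ∀ x : ZMod n → ℤ, IsPM x → ∀ t, -x t = 1 ∨ -x t = -1 := fun x hx t => by
    rcases hx t with h | h
    · right; rw [h]
    · left; rw [h]; norm_num
  rcases x with ⟨⟨⟩ | ⟨⟩⟩ | ⟨i | i⟩ <;> rcases y with ⟨⟨⟩ | ⟨⟩⟩ | ⟨k | k⟩ <;>
    simp only [twoCircCore, Matrix.of_apply] <;>
    first | trivial | exact ha _ | exact hb _ | exact hneg a ha _

/-- the order of the bordered two-circulant matrix is `2n + 2`. [cite: FletcherGysinSeberry2001, §1 (the 2×(ℓ+1) plug-in)] -/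
lemma card_coreIdx : Fintype.card (CoreIdx n) = 2 * n + 2 := by
  simp [CoreIdx, Fintype.card_sum, ZMod.card]; ring

/-- negating one sequence preserves the Legendre-pair property. [folklore] -/
private lemma legendrePair_neg_left (a b : ZMod n → ℤ) (h : LegendrePair a b) : LegendrePair (-a) b := by
  obtain ⟨ha, hb, hL⟩ := h
  refine ⟨fun i => ?_, hb, fun s hs => ?_⟩
  · rcases ha i with h | h <;> simp [h]
  · rw [← hL s hs]; unfold PAF; simp

/-- … and symmetrically for the second sequence. [folklore] -/
private lemma legendrePair_neg_right (a b : ZMod n → ℤ) (h : LegendrePair a b) : LegendrePair a (-b) := by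
  obtain ⟨ha, hb, hL⟩ := h
  refine ⟨ha, fun i => ?_, fun s hs => ?_⟩
  · rcases hb i with h | h <;> simp [h]
  · rw [← hL s hs]; unfold PAF; simp

/-- **Fletcher–Gysin–Seberry.** A Legendre pair of length `n` gives a Hadamard matrix of order `2n + 2`: after
normalising the row sums to `+1` (each is `±1` by `rowsum_sq`; negate a sequence if necessary) the bordered
two-circulant matrix has entries `±1` and satisfies `H Hᵀ = (2n + 2)·I`.  In particular a Legendre pair of length
`333` would give a Hadamard matrix of order `668`. [cite: FletcherGysinSeberry2001, §1 (the 2×(ℓ+1) plug-in)] -/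
theorem exists_hadamard_of_legendrePair (a b : ZMod n → ℤ) (h : LegendrePair a b) :
    ∃ H : Matrix (CoreIdx n) (CoreIdx n) ℤ,
      (∀ x y, H x y = 1 ∨ H x y = -1) ∧ H * Hᵀ = (2 * (n : ℤ) + 2) • (1 : Matrix (CoreIdx n) (CoreIdx n) ℤ) := by
  -- normalise the row sum of `a`
  obtain ⟨a', ha', hab'⟩ : ∃ a' : ZMod n → ℤ, (∑ i, a' i) = 1 ∧ LegendrePair a' b := by
    rcases pm_of_sq _ _ (rowsum_sq a b h) with h1 | h1
    · exact ⟨a, h1, h⟩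
    · refine ⟨-a, ?_, legendrePair_neg_left a b h⟩
      simp only [Pi.neg_apply, Finset.sum_neg_distrib, h1, neg_neg]
  -- normalise the row sum of `b`
  obtain ⟨b', hb', hab⟩ : ∃ b' : ZMod n → ℤ, (∑ i, b' i) = 1 ∧ LegendrePair a' b' := by
    have hsq := rowsum_sq a' b hab'
    rcases pm_of_sq _ _ (by rw [add_comm]; exact hsq) with h1 | h1
    · exact ⟨b, h1, hab'⟩
    · refine ⟨-b, ?_, legendrePair_neg_right a' b hab'⟩
      simp only [Pi.neg_apply, Finset.sum_neg_distrib, h1, neg_neg]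
  exact ⟨twoCircCore a' b', twoCircCore_pm a' b' hab.1 hab.2.1, twoCircCore_mul_transpose a' b' hab ha' hb'⟩

end Literature.Combinatorics.Designs.LegendrePairs
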